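import Summits.Ventures.PercRepro.Night2GoodTwoD2Count
import Summits.Ventures.PercRepro.Night2GoodTwoD2Axes2

/-!
# night-2: the `dshGT2` column bound at every target

At a target `S` with at most one coloop off `K`: if no covered lossy big pair loads `S` at distance two, every
`dshGT2` term is at most the `dshGT` term and the bound is `dload_gt_le_cap2_of_card_coloops_le_one'''`; otherwise
`S` is a distance-2 target, the `dshGT` load vanishes there (`dload_gt_eq_zero_of_mem_d2Targets`), every nonzero
`dshGT2` term is a distance-2 share `≤ (53/936)/|d2Targets| ≤ 53/7488` (`dshGT2_le_of_mem_d2Targets`,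
`eight_le_card_d2Targets`), and there are at most `36` such terms (`card_loadPairs_le_36`), so the load is
`≤ 36 · 53/7488 < 23/72 ≤ cap2 S`.  Targets with two or more coloops off `K` receive nothing
(`dload_gt2_le_cap2_of_two_le_card_coloops`).  Hence `dload_gt2_le_cap2` at EVERY target `S ⊆ G` containing `K`
— the column side (first hypothesis) of `localShadowHall_of_gt2` (paper NIGHT-2-g30 §7.0).
-/

namespace PercRepro.Shadow

open PercRepro.ThmH PercRepro.PerFlat

variable {α : Type*} [DecidableEq α] {M : Matroid α} [M.Finite] {G : Finset α}

/-- **The `dshGT2` column bound at a target with at most one coloop off `K`, given at most `36` nonzero terms.** -/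
theorem dload_gt2_le_cap2_of_card_coloops_le_one_of_count (hG : G ∈ flatsQ M (5 + 1))
    (hd : (gr M \ G).card = 2) (hk : kColoops M G = 1)
    (hs : ∀ e ∈ gr M, ∀ f ∈ gr M, e ≠ f → rkN M {e, f} = 2) (hl : ∀ e ∈ gr M, M.Indep {e})
    (hfat : (fatClosures M 5 G 2).card ≤ 1) {S : Finset α} (hSG : S ⊆ G) (hKS : coloops M G ⊆ S)
    (hc1 : (coloops M (S \ coloops M G)).card ≤ 1)
    (hcount : ((loadPairs M G).filter (fun p => dshGT2 M 5 G p.1 p.2 S ≠ 0)).card ≤ 36) :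
    dload M 5 G (bigP M G) (dshGT2 M 5 G) S ≤ cap2 M 5 G S := by
  have hd' : (gr M \ G).card ≤ 5 := by omega
  by_cases hd2 : ∃ B ∈ thinMembers M 5 G, bigP M G B ∧ ∃ z ∈ G \ clF M B,
      ¬ (gtPts M 5 G (insert z B)).Nonempty ∧ S ∈ d2Targets M 5 G (insert z B) ∧ loss M 5 G B z ≠ 0
  · -- `S` is a distance-2 target of a covered lossy big pair
    obtain ⟨B, hB, hbig, z, hz, hno, hS, hloss⟩ := hd2
    have hgt0 := dload_gt_eq_zero_of_mem_d2Targets hG hd hk hs hl hB hbig hz hloss hno hS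
    -- every nonzero term is a distance-2 share of a covered lossy big pair
    have hterm : ∀ p ∈ loadPairs M G, dshGT2 M 5 G p.1 p.2 S ≠ 0 →
        dshGT2 M 5 G p.1 p.2 S ≤ 53 / 7488 := by
      intro p hp hne
      unfold loadPairs at hp
      rw [Finset.mem_sigma, Finset.mem_filter] at hp
      have hloss' : loss M 5 G p.1 p.2 ≠ 0 := fun h0 => hne (dshGT2_eq_zero_of_loss_eq_zero h0 S)
      -- the `dshGT` term vanishes, so the pair is a distance-2 pair at `S`
      have hgt : dshGT M 5 G p.1 p.2 S = 0 :=
        dshGT_eq_zero_of_mem_d2Targets hG hd hk hs hl hB hbig hz hloss hno hS hp.1.1 hp.2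
      have hcase : ¬ (gtPts M 5 G (insert p.2 p.1)).Nonempty ∧ S ∈ d2Targets M 5 G (insert p.2 p.1) := by
        by_contra hnot
        apply hne
        have hle := dshGT2_le_dshGT_of_not_d2 hG hd' (B := p.1) (z := p.2) (S := S) (by
          by_cases h1 : (gtPts M 5 G (insert p.2 p.1)).Nonempty
          · exact Or.inl h1
          · right
            intro h2
            exact hnot ⟨h1, h2⟩)
        have hnn : 0 ≤ dshGT2 M 5 G p.1 p.2 S := dshGT2_nonneg hG hd' p.1 p.2 S
        rw [hgt] at hle
        exact le_antisymm hle hnn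
      have h8 := eight_le_card_d2Targets hG hd hk hs hl hfat hp.1.1 hp.1.2 hp.2 hloss' hcase.1
      have hshare := dshGT2_le_of_mem_d2Targets hG hd hk hs hl hfat hp.1.1 hp.1.2 hp.2 hloss' hcase.1 hcase.2
      have h8' : (8 : ℚ) ≤ ((d2Targets M 5 G (insert p.2 p.1)).card : ℚ) := by exact_mod_cast h8
      calc dshGT2 M 5 G p.1 p.2 S ≤ (53 / 936) / ((d2Targets M 5 G (insert p.2 p.1)).card : ℚ) := hshare
        _ ≤ (53 / 936) / 8 := by
            apply div_le_div_of_nonneg_left (by norm_num) (by norm_num) h8'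
        _ = 53 / 7488 := by norm_num
    -- the sum over the nonzero terms
    rw [dload_eq_sum_loadPairs]
    have hsplit : ∑ p ∈ loadPairs M G, dshGT2 M 5 G p.1 p.2 S =
        ∑ p ∈ (loadPairs M G).filter (fun p => dshGT2 M 5 G p.1 p.2 S ≠ 0), dshGT2 M 5 G p.1 p.2 S := by
      rw [Finset.sum_filter_of_ne]
      intro p _ hne
      exact hne
    rw [hsplit]
    have hle : ∑ p ∈ (loadPairs M G).filter (fun p => dshGT2 M 5 G p.1 p.2 S ≠ 0), dshGT2 M 5 G p.1 p.2 S ≤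
        ∑ _p ∈ (loadPairs M G).filter (fun p => dshGT2 M 5 G p.1 p.2 S ≠ 0), (53 / 7488 : ℚ) := by
      apply Finset.sum_le_sum
      intro p hp
      rw [Finset.mem_filter] at hp
      exact hterm p hp.1 hp.2
    rw [Finset.sum_const, nsmul_eq_mul] at hle
    have hc36 : (((loadPairs M G).filter (fun p => dshGT2 M 5 G p.1 p.2 S ≠ 0)).card : ℚ) ≤ 36 := by
      exact_mod_cast hcount
    -- the capacity: `cap2 S ≥ 11/18 − 7/24 = 23/72`
    have hcapS := capS_ge_eleven_eighteenths_two_one hd hk hSG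
    have hcap2 := cap2_ge_capS_sub_L1_of_le hG hd' S
    have hL1 := L1_le_card_coloops_mul hG hd S
    have hc1' : ((coloops M (S \ coloops M G)).card : ℚ) ≤ 1 := by exact_mod_cast hc1
    have : L1 M 5 G S ≤ 7 / 24 := by nlinarith
    calc ∑ p ∈ (loadPairs M G).filter (fun p => dshGT2 M 5 G p.1 p.2 S ≠ 0), dshGT2 M 5 G p.1 p.2 S
        ≤ (((loadPairs M G).filter (fun p => dshGT2 M 5 G p.1 p.2 S ≠ 0)).card : ℚ) * (53 / 7488) := hle
      _ ≤ 36 * (53 / 7488) := by gcongr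
      _ ≤ cap2 M 5 G S := by linarith
  · -- no covered lossy big pair loads `S` at distance two: the `dshGT` bound transfers
    push Not at hd2
    have hle : dload M 5 G (bigP M G) (dshGT2 M 5 G) S ≤ dload M 5 G (bigP M G) (dshGT M 5 G) S := by
      unfold dload
      refine Finset.sum_le_sum fun B hB => Finset.sum_le_sum fun z hz => ?_
      rw [Finset.mem_filter] at hB
      apply dshGT2_le_dshGT_of_not_d2' hG hd'
      by_cases h1 : (gtPts M 5 G (insert z B)).Nonempty
      · exact Or.inl h1
      by_cases h2 : S ∈ d2Targets M 5 G (insert z B)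
      · exact Or.inr (Or.inr (hd2 B hB.1 hB.2 z hz (Finset.not_nonempty_iff_eq_empty.1 h1) h2))
      · exact Or.inr (Or.inl h2)
    exact hle.trans (dload_gt_le_cap2_of_card_coloops_le_one''' hG hd hk hs hl hfat hSG hKS hc1)

/-- **The `dshGT2` column bound at every target with at most one coloop off `K`.** -/
theorem dload_gt2_le_cap2_of_card_coloops_le_one (hG : G ∈ flatsQ M (5 + 1))
    (hd : (gr M \ G).card = 2) (hk : kColoops M G = 1)
    (hs : ∀ e ∈ gr M, ∀ f ∈ gr M, e ≠ f → rkN M {e, f} = 2) (hl : ∀ e ∈ gr M, M.Indep {e})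
    (hfat : (fatClosures M 5 G 2).card ≤ 1) {S : Finset α} (hSG : S ⊆ G) (hKS : coloops M G ⊆ S)
    (hc1 : (coloops M (S \ coloops M G)).card ≤ 1) :
    dload M 5 G (bigP M G) (dshGT2 M 5 G) S ≤ cap2 M 5 G S := by
  have hd' : (gr M \ G).card ≤ 5 := by omega
  by_cases hd2 : ∃ B ∈ thinMembers M 5 G, bigP M G B ∧ ∃ z ∈ G \ clF M B,
      ¬ (gtPts M 5 G (insert z B)).Nonempty ∧ S ∈ d2Targets M 5 G (insert z B) ∧ loss M 5 G B z ≠ 0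
  · obtain ⟨B, hB, hbig, z, hz, hno, hS, hloss⟩ := hd2
    exact dload_gt2_le_cap2_of_card_coloops_le_one_of_count hG hd hk hs hl hfat hSG hKS hc1
      (card_loadPairs_le_36 hG hd hk hs hl hSG hKS hc1 hB hbig hz hloss hno hS)
  · push Not at hd2
    have hle : dload M 5 G (bigP M G) (dshGT2 M 5 G) S ≤ dload M 5 G (bigP M G) (dshGT M 5 G) S := by
      unfold dload
      refine Finset.sum_le_sum fun B hB => Finset.sum_le_sum fun z hz => ?_
      rw [Finset.mem_filter] at hB
      apply dshGT2_le_dshGT_of_not_d2' hG hd'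
      by_cases h1 : (gtPts M 5 G (insert z B)).Nonempty
      · exact Or.inl h1
      by_cases h2 : S ∈ d2Targets M 5 G (insert z B)
      · exact Or.inr (Or.inr (hd2 B hB.1 hB.2 z hz (Finset.not_nonempty_iff_eq_empty.1 h1) h2))
      · exact Or.inr (Or.inl h2)
    exact hle.trans (dload_gt_le_cap2_of_card_coloops_le_one''' hG hd hk hs hl hfat hSG hKS hc1)

/-- **The `dshGT2` column bound at every target `S ⊆ G` containing `K`** — the first hypothesis of
`localShadowHall_of_gt2` in cell `(2, 1)` (simple, loopless, at most one fat closure). -/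
theorem dload_gt2_le_cap2 (hG : G ∈ flatsQ M (5 + 1)) (hd : (gr M \ G).card = 2) (hk : kColoops M G = 1)
    (hs : ∀ e ∈ gr M, ∀ f ∈ gr M, e ≠ f → rkN M {e, f} = 2) (hl : ∀ e ∈ gr M, M.Indep {e})
    (hfat : (fatClosures M 5 G 2).card ≤ 1) {S : Finset α} (hSG : S ⊆ G) (hKS : coloops M G ⊆ S) :
    dload M 5 G (bigP M G) (dshGT2 M 5 G) S ≤ cap2 M 5 G S := by
  by_cases hc1 : (coloops M (S \ coloops M G)).card ≤ 1
  · exact dload_gt2_le_cap2_of_card_coloops_le_one hG hd hk hs hl hfat hSG hKS hc1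
  · exact dload_gt2_le_cap2_of_two_le_card_coloops hG hd hk hs hl hSG (by omega)

end PercRepro.Shadow
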